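import Literature.AlgebraicGeometry.ModuliOfAbelianVarieties.Lan2013.Sec731ConvexityConditions
import HarnessLib

/-!
# [Lan2013] §7.3.1 — companion proofs (`…Holds`) for `Sec731ConvexityConditions.lean`: Prop. 7.3.1.2 3, the dual `K^∨_{pol}`

[cite: Lan2013PELCompactifications, Prop. 7.3.1.2 (p. 475)]  Squad-TS companion (RULING TS-1: theorems only, no new named fact, no
instance, no notation) discharging `Lan2013_7312_part3` — the three TYPED clauses of Prop. 7.3.1.2 3 about
`K^∨_{pol_{Φ_H}} := {x ∈ (S_{Φ_H})_ℝ : ⟨x, y⟩ ≥ 1 ∀ y ∈ K_{pol_{Φ_H}}}` (`core 𝔗 pol`): «a convex subset … such that `ℝ_{≥1} · K^∨_{pol} = K^∨_{pol}`»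
and (the typed weak form of «in `(P^∨_{Φ_H})_ℝ`») `⟨x, y⟩ ≥ 0` for `x ∈ K^∨_{pol}`, `y ∈ P_{Φ_H}`.  These hold for EVERY torus datum and
every function satisfying Def. 7.3.1.1 (`IsPolarizationFunction`): `K^∨_{pol}` is an intersection of closed half-spaces, hence convex and
stable under scaling by `t ≥ 1` (its defining pairings are `≥ 1 > 0`); and for `0 ≠ y ∈ P_{Φ_H}` one has `pol(y) > 0` (Def. 7.3.1.1 2) and
`pol(pol(y)^{−1} y) = 1` (homogeneity, Def. 7.3.1.1 1), so `pol(y)^{−1} y ∈ K_{pol}` (`P_{Φ_H}` is a cone) and `⟨x, y⟩ = pol(y) ⟨x, pol(y)^{−1} y⟩ ≥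
pol(y) > 0`.  (Prop. 7.3.1.2 2's `Convex (cocore)` clause, by contrast, needs the convexity of `P_{Φ_H}`, which the posited datum does not
carry — it stays a consumer predicate, as the parent's module docstring explains.)  The admissibility hypothesis of the fact is not used.
-/

noncomputable section

namespace Literature.AlgebraicGeometry.ModuliOfAbelianVarieties.Lan2013.Sec731ConvexityConditions

open Literature.AlgebraicGeometry.ModuliOfAbelianVarieties.Lan2013.Sec72Defs
open Literature.AlgebraicGeometry.ModuliOfAbelianVarieties.Lan2013.Sec71AutomorphicFormsFourierJacobi

universe u

variable {R : Type u} [CommRing R] {GA : Type u} [Group GA]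
variable {𝔇 : MinimalCompactificationTower R GA} {H : Subgroup GA} {c : 𝔇.Cusp H}

/-- For `0 ≠ y ∈ P_{Φ_H}` and a polarization function `pol`, the rescaled vector `pol(y)^{−1} • y` lies in the cocore `K_{pol}`
(Def. 7.3.1.1 1–2: `pol(y) > 0`, `pol(t y) = t pol(y)` for `t ≥ 0`, and `P_{Φ_H}` is a cone).
[cite: Lan2013PELCompactifications, Prop. 7.3.1.2 (p. 475)] -/
theorem inv_pol_smul_mem_cocore (𝔗 : CuspTorusData 𝔇 H c) {Sig : Set (Set (DualR 𝔗.S))} {pol : DualR 𝔗.S → ℝ}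
    (hpol : IsPolarizationFunction 𝔗 Sig pol) {y : DualR 𝔗.S} (hy : y ∈ 𝔗.P) (hy0 : y ≠ 0) :
    (pol y)⁻¹ • y ∈ cocore 𝔗 pol := by
  obtain ⟨-, -, -, hhom, -, hpos, -, -⟩ := hpol
  have hp : 0 < pol y := hpos y hy hy0
  refine ⟨𝔗.isCone_P _ (inv_pos.mpr hp) y hy, ?_⟩
  rw [hhom y hy _ (inv_pos.mpr hp).le, inv_mul_cancel₀ hp.ne']

/-- **Prop. 7.3.1.2 3 holds** (discharge of `Lan2013_7312_part3`): `K^∨_{pol}` is convex, `ℝ_{≥1} · K^∨_{pol} = K^∨_{pol}`, and every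
`x ∈ K^∨_{pol}` pairs nonnegatively with `P_{Φ_H}`.  [cite: Lan2013PELCompactifications, Prop. 7.3.1.2 (p. 475)] -/
theorem Lan2013_7312_part3_holds (𝔗 : CuspTorusData 𝔇 H c) (Sig : Set (Set (DualR 𝔗.S))) (pol : DualR 𝔗.S → ℝ) :
    Lan2013_7312_part3 𝔗 Sig pol := by
  intro _ hpol
  refine ⟨?_, ?_, ?_⟩
  · -- convexity: an intersection of the closed half-spaces `{x | 1 ≤ x y}`, `y ∈ K_{pol}`
    intro x hx x' hx' a b ha hb hab z hz
    have h1 := hx z hz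
    have h2 := hx' z hz
    show (1 : ℝ) ≤ (a • x + b • x') z
    simp only [LinearMap.add_apply, LinearMap.smul_apply, smul_eq_mul]
    nlinarith
  · -- `ℝ_{≥1} · K^∨ = K^∨`
    ext x
    constructor
    · rintro ⟨t, ht, x', hx', rfl⟩ z hz
      have h1 := hx' z hz
      show (1 : ℝ) ≤ (t • x') z
      simp only [LinearMap.smul_apply, smul_eq_mul]
      nlinarith
    · intro hx
      exact ⟨1, le_rfl, x, hx, (one_smul ℝ x).symm⟩
  · -- nonnegative pairing with `P_{Φ_H}`
    intro x hx y hy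
    by_cases hy0 : y = 0
    · simp [hy0]
    obtain ⟨-, -, -, -, -, hpos, -, -⟩ := id hpol
    have hp : 0 < pol y := hpos y hy hy0
    have h1 : (1 : ℝ) ≤ x ((pol y)⁻¹ • y) := hx _ (inv_pol_smul_mem_cocore 𝔗 hpol hy hy0)
    rw [map_smul, smul_eq_mul] at h1
    nlinarith [inv_pos.mpr hp, h1]

end Literature.AlgebraicGeometry.ModuliOfAbelianVarieties.Lan2013.Sec731ConvexityConditions

end
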